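import Summits.ResolutionOfSingularities.ResolutionOfSingularities.Theorems.TameCutKernels
import Summits.ResolutionOfSingularities.ResolutionOfSingularities.Theorems.AbsoluteContactAxes
import Summits.ResolutionOfSingularities.ResolutionOfSingularities.Theorems.TameCutStage
import Summits.ResolutionOfSingularities.ResolutionOfSingularities.Theorems.LatencyCutCells
import Literature.AlgebraicGeometry.Resolution.HasseSystemRegularParameters
import Literature.AlgebraicGeometry.Resolution.SmoothOfRegularFibre
import Mathlib.Algebra.CharP.Lemmas
import Mathlib.Algebra.CharP.Algebra
import Mathlib.Algebra.Algebra.Bilinear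
import Mathlib.FieldTheory.RatFunc.Degree
import HarnessLib

/-!
# FrobeniusGain — decomp-res node «FrobeniusForm» (lens-4 g23, critic row 144), tree file 1/4 of the node

Content VERBATIM from the decomp-res lens-4 g23 file `HOME/decomp-res-lens-4/g23/FrobeniusForm.lean` (sha256
24d32aa2…, 1018 l; HOME = run/shared/lean/pub/decomp-res).
Critic: CRITIC-LEDGER row 144 (CLEARED 2026-08-30T20:58:02Z; MAP node: the two-way census dictionary «initial form
a `p`-power form ⟺ absolutely contact-free»
as a KERNEL theorem).  Split by the lens's sections for the 400-line limit (the critic's `PPowerForm` = §55–§57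
is two files here).  Landed by decomp-res writer g7
in the lens's namespace `…Theorems.HugValuationCut`.  Asides: NONE new — 28338
`LCNoWildContactFreeOffLocusTowers` stays the booked residual; `NoWildPPowerOffLocusTowers`
lands as a def with its up-link, to supersede 28338 only when an every-field iff makes the re-location exact (critic).

§54 (l. 79–202) THE FROBENIUS GAIN — pure characteristic-`p` algebra, hypothesis-free: `charP_end`,
`iterate_commMul_eq_commMul_pow`,
`isDiffOpLE_iterate_commMul`, `isDiffOpLE_commMul_pow`, `apply_mul_pow_mem_pow`, `apply_mem_sq_of_mem_pPowerSpan`,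
`diffIdeal_le_sq_of_le_pPowerSpan`.  PROVED, 0 sorry.

## The lens's node description (VERBATIM)

/-!
# FrobeniusForm — decomp-res node (lens-4 «minimal counterexample / extremal reduction», g23): THE TWO-WAY CENSUS
DICTIONARY «initial form a `p`-power form ⟺ absolutely contact-free» as a KERNEL THEOREM, refining the MaxContactCut
asides 32260 `NoSingularSurfaceHuggingTowers` (host) / 30253 `NoForcedTowers` (root) / 31572 `NoWildHuggingTowers` and the
g22 located residual «wild, absolutely contact-free at every stage» (critic window g23 = CRITIC-LEDGER row 137, MAP item 3:
«the census-proxy dictionary "initial-form exponent ≢ 0 mod p ⟺ IsAbsContactAt" as a TWO-WAY kernel theorem»).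

HOME = run/shared/lean/pub/decomp-res.  Written directly against the TREE (landed g21 «TameCut»: `Theorems/TameCutClasses`,
`TameCutKernels`, `MaxContactCutTameCut`; landed g22 «LatencyCut»: `Theorems/TameCutStage`, `LatencyCutClasses`,
`LatencyCutCells` — IMPORTED, nothing re-derived); no copy of an earlier generation.

## THE OBJECT: `PPowerFormAt p 𝓘 n y` (NEW, intrinsic, no coordinates, no field)

`p ∣ n` and `𝓘_y ⊆ ⟨h^p : h ∈ 𝔪_y^{n/p}⟩ + 𝔪_y^{n+1}`: the degree-`n` initial ideal of `𝓘` at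
`y` is spanned over `κ(y)` by
`p`-th POWERS of forms of degree `n/p` — in any regular system of parameters `u`, every monomial of the initial form of every
`f ∈ 𝓘_y` carrying a unit coefficient has ALL its exponents `≡ 0 (mod p)` (§55 `mem_pPowerSpan_of_coeff` /
`exists_hasse_apply_of_coeff`: the two coordinate readings).  This is EXACTLY the census bit of HOME/census/it/T-wild-in
(«initial-form exponent ≢ 0 mod p at an 𝔽_p-point»), made intrinsic.

## THE DICTIONARY (KERNEL, PROVED, hypothesis-free, standard axioms)

* (§54, ⟸, ANY scheme, ANY point whose local ring has characteristic `p`) `not_isAbsContactAt_of_pPowerFormAt`: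
  a `p`-power form is ABSOLUTELY CONTACT-FREE — `Diff^{≤ n−1}_ℤ(𝓘_y) ⊆ 𝔪_y²`.  Engine = THE FROBENIUS GAIN
  `isDiffOpLE_commMul_pow`: in characteristic `p`, `(ad u)^p = ad(u^p)` (Jacobson), so commuting an operator of order `≤ N`
  with a `p`-th power lowers its order by `p`, not `1`; hence (`apply_mul_pow_mem_pow`) an operator of order `≤ N < p·m`
  maps `c · h^p`, `h ∈ I^m`, into `I^p ⊆ I²`.  No smoothness, no field, no Hasse system, no (UNR).
* (§55–§56, ⟹) `exists_hasse_apply_of_not_mem_pPowerSpan`: along ANY truncated Hasse–Schmidt system a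
NON-`p`-power form has a
  unit-coefficient monomial with an exponent `β_i ≢ 0 (mod p)` and then `Δ_{β−e_i} f ∈ 𝔪 ∖ 𝔪²`
(the LUCAS BITE made
  intrinsic; no residue-field hypothesis, no coefficient field).
* (§57) THE TWO-WAY THEOREM `isAbsContactAt_iff_not_pPowerFormAt`: on a base of the class over a PERFECT field `k` of
  characteristic `p`, at EVERY point `y` (closed or not) of an ideal of order `n ≥ 1`:
  `IsAbsContactAt 𝓘 n y ⟺ ¬ PPowerFormAt p 𝓘 n y`; the same over every FINITELY GENERATED field (`FGGround`, perfect or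
  not: `isAbsContactAt_iff_not_pPowerFormAt_fg`).  Corollaries: the TAME theorems `isAbsContactAt_of_tame_perfect` (every
  point; g21 needed a separable residue field in the smooth locus) and `isAbsContactAt_of_tame_fg`.
* (§58) TOWERS: `contactFree_iff_pPowerTower` — over a perfect (or f.g.) ground field a forced tower is ABSOLUTELY
  CONTACT-FREE AT EVERY STAGE (g22's located wild residual) IFF ITS INITIAL IDEAL IS A `p`-POWER FORM AT EVERY STAGE; and
  `contactHugging_of_not_pPowerFormAt_root`: a tower whose ROOT initial ideal is not a `p`-power form hugs a regular
  hypersurface germ for ever (31571's class) — the certified reading of the census transport T-wild-in (404/404 tame seeds: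
  not `p`-power at the root ⟹ absolute contact) and of its `j*`-bit at every stage, BOTH WAYS.
* (§59) BY NAME against the landed g22 classes: the field-free predicate `PPowerTower n T`; `contactFreeTower_of_pPowerTower`
  (EVERY field) and `contactFreeTower_iff_pPowerTower_perfect/_fg`; the CUT of the tree aside `NoWildContactFreeOffLocusTowers`
  (`Theorems/LatencyCutCells`) = `NoWildPPowerOffLocusTowers` (THE LOCATED RESIDUAL: wild towers whose initial ideal is a
  `p`-power form at EVERY marked point — the strict kangaroos by letter) ∧ `NoWildContactFreeNonPPowerOffLocusTowers`, EXACT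
  (`noWildContactFreeOffLocusTowers_iff_g23`), the second conjunct's PERFECT and FINITELY-GENERATED columns EMPTY by kernel
  (`contactFreeNonPPower_perfect_empty`, `contactFreeNonPPower_fg_empty` — all weights, all classes).

(Sources: EGAIV4 §16.8 (Déf. 16.8.1, Prop. 16.8.8), Thm. 16.11.2, 0_IV 21.9, 22.5; Jacobson1962 (restricted Lie algebras,
`(ad x)^p = ad x^p`); StacksProject 00TV, 07P7; Matsumura1987 §30; Giraud1975; EncinasVillamayor2000 Thm. 4.9;
VillamayorU2008ReesDiff §4.1; CossartPiltant2008 Prop. 4.2; Kawanoue2007 Ch. 4; BierstoneGrigorievMilmanWlodarczyk2011 3.6.2.)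
-/

[WRITER NOTE (decomp-res writer g7): file split only; namespace, section variables and every declaration exactly as in the lens (global `set_option` dropped).  The lens's
first import `MaxContactCutTameCut` (in the Theses cone, unused by any proof here) is replaced by the cone-free `TameCutKernels` + `AbsoluteContactAxes` and the then-dangling
`open …Theses` dropped, so the whole node is OUTSIDE the Theses cone and importable by the route file when a later every-field iff re-locates 28338.]

(Sources: Abad2019 Thm 4.11 / Prop 6.3; Giraud1975; CossartJannsenSaito2020; CossartPiltant2019 Prop. 2.50; KawanoueMatsuki2016 §0.4.2; EGA IV₄ 16.11.2; Stacks 00TV.)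
-/

noncomputable section

open CategoryTheory AlgebraicGeometry IsLocalRing
open Literature.AlgebraicGeometry.Resolution
open Summit.ResolutionOfSingularities.ResolutionOfSingularities.Theorems
open WeakOrderReduction ForcedTowerClasses DivergentTowerClasses MonomialTowerClasses
open HugDimensionClasses HugDimensionKernels SurfaceShadowClasses SurfaceShadowKernels
open NearPointCut (SingularClass)
open AbsoluteContactClasses (IsAbsContactAt SepResidueAt diffIdeal_restrict_le stalkMap_comp_toStalk_eq_stalkHom)
open scoped BigOperators

namespace Summit.ResolutionOfSingularities.ResolutionOfSingularities.Theorems.HugValuationCut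

/-! ## §54 (g23 · NEW · KERNEL, pure algebra, characteristic `p`, hypothesis-free) THE FROBENIUS GAIN — commuting with a
`p`-th power lowers the order of a differential operator by `p`; `p`-power forms are invisible to operators of order
`< p·m`. -/

section FrobeniusGain

variable {R A : Type*} [CommRing R] [CommRing A] [Algebra R A] (p : ℕ) [Fact p.Prime] [CharP A p]

omit [Fact p.Prime] in
/-- `CharP` passes to the endomorphism algebra (it contains `A` via left multiplications). [folklore] -/
theorem charP_end : CharP (Module.End R A) p :=
  charP_of_injective_ringHom (f := (Algebra.lmul R A).toRingHom) (Algebra.lmul_injective) p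

/-- **`(ad u)^p = ad (u^p)` in characteristic `p`** (Jacobson): the `p`-fold iterated commutator of an operator with
(multiplication by) `y` is its commutator with `y^p` — in `End(End A)`, `ad = r − l` with `r`, `l` commuting and
`(r − l)^p = r^p − l^p`. (Sources: EGAIV4, Prop. 16.8.8 (16.8.8.1).) -/
theorem iterate_commMul_eq_commMul_pow (D : A →ₗ[R] A) (y : A) :
    (fun E => commMul R E y)^[p] D = commMul R D (y ^ p) := by
  haveI : CharP (Module.End R A) p := charP_end p
  haveI : CharP (Module.End R (Module.End R A)) p :=
    charP_of_injective_ringHom (f := (Algebra.lmul R (Module.End R A)).toRingHom) (Algebra.lmul_injective) p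
  set L : Module.End R A := LinearMap.mulLeft R y with hL
  set r : Module.End R (Module.End R A) := LinearMap.mulRight R L with hr
  set l : Module.End R (Module.End R A) := LinearMap.mulLeft R L with hl
  have hF : (fun E => commMul R E y) = ⇑(r - l) := by
    funext E
    rw [LinearMap.sub_apply, hr, hl, LinearMap.mulRight_apply, LinearMap.mulLeft_apply]
    rfl
  have hcomm : Commute r l := (LinearMap.commute_mulLeft_right L L).symm
  rw [hF, ← Module.End.coe_pow, sub_pow_char_of_commute (R := Module.End R (Module.End R A)) (x := r) (y := l)
    (p := p) hcomm, hr, hl, LinearMap.pow_mulRight,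
    LinearMap.pow_mulLeft, hL, LinearMap.pow_mulLeft, LinearMap.sub_apply, LinearMap.mulRight_apply,
    LinearMap.mulLeft_apply]
  erw [LinearMap.pow_mulLeft]
  rfl

omit [Fact p.Prime] [CharP A p] in
/-- `j` commutators lower the order by `j`. (Sources: EGAIV4, Prop. 16.8.8 (b).) -/
theorem isDiffOpLE_iterate_commMul (y : A) :
    ∀ (j N : ℕ) (D : A →ₗ[R] A), IsDiffOpLE R N D → IsDiffOpLE R (N - j) ((fun E => commMul R E y)^[j] D)
  | 0, N, D, hD => by simpa using hD
  | j + 1, N, D, hD => by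
    rw [Function.iterate_succ_apply']
    have ih := isDiffOpLE_iterate_commMul y j N D hD
    cases hNj : N - j with
    | zero =>
      rw [hNj] at ih
      rw [ih y, show N - (j + 1) = 0 by omega]
      exact IsDiffOpLE.zero (R := R) (A := A) 0
    | succ M =>
      rw [hNj] at ih
      rw [show N - (j + 1) = M by omega]
      exact ih y

/-- **THE FROBENIUS GAIN (KERNEL, PROVED)**: commuting an operator of order `≤ N` with a `p`-th power gives an operator of
order `≤ N − p`. (Sources: EGAIV4, Prop. 16.8.8.) -/
theorem isDiffOpLE_commMul_pow {N : ℕ} {D : A →ₗ[R] A} (hD : IsDiffOpLE R N D) (y : A) :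
    IsDiffOpLE R (N - p) (commMul R D (y ^ p)) := by
  rw [← iterate_commMul_eq_commMul_pow p D y]
  exact isDiffOpLE_iterate_commMul y p N D hD

/-- **THE FROBENIUS GAIN LEMMA (KERNEL, PROVED)**: an operator of order `≤ N < p·m` maps `c · h^p`, `h ∈ I^m`, into `I^p`
(induction on `m`: `D(c (a y)^p) = [D, y^p](c a^p) + y^p D(c a^p)` with `[D, y^p]` of order `≤ N − p`).
(Sources: EGAIV4, Prop. 16.8.8; VillamayorU2008ReesDiff, §4.1.) -/
theorem apply_mul_pow_mem_pow (I : Ideal A) :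
    ∀ (m N : ℕ) (D : A →ₗ[R] A), IsDiffOpLE R N D → N < p * m → ∀ {h : A}, h ∈ I ^ m → ∀ c : A, D (c * h ^ p) ∈ I ^ p
  | 0, N, D, _, hN, h, _, c => by omega
  | m + 1, N, D, hD, hN, h, hh, c => by
    rw [pow_succ] at hh
    revert c
    refine Submodule.mul_induction_on hh (fun a ha y hy => ?_) (fun x z hx hz => ?_)
    · intro c
      have hsplit : D (c * (a * y) ^ p) = commMul R D (y ^ p) (c * a ^ p) + y ^ p * D (c * a ^ p) := by
        rw [commMul_apply, mul_pow]; ring_nf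
      rw [hsplit]
      refine Ideal.add_mem _ ?_ (Ideal.mul_mem_right _ _ (Ideal.pow_mem_pow hy p))
      by_cases hpN : p ≤ N
      · have hpm : p * (m + 1) = p * m + p := by ring
        exact apply_mul_pow_mem_pow I m (N - p) _ (isDiffOpLE_commMul_pow p hD y) (by omega) ha c
      · -- `N < p`: the commutator with `y^p` is an `(N+1)`-fold commutator of `D`, hence vanishes
        have h0 : (fun E => commMul R E y)^[p] D = 0 := by
          have h1 : (fun E => commMul R E y)^[N + 1] D = 0 := by
            have h2 := isDiffOpLE_iterate_commMul y N N D hD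
            rw [Nat.sub_self] at h2
            rw [Function.iterate_succ_apply']
            exact h2 y
          obtain ⟨e, he⟩ : ∃ e, p = e + (N + 1) := ⟨p - (N + 1), by omega⟩
          rw [he, Function.iterate_add_apply, h1]
          clear he
          induction e with
          | zero => rfl
          | succ e ih => rw [Function.iterate_succ_apply', ih, commMul_zero_left]
        rw [← iterate_commMul_eq_commMul_pow p D y, h0, LinearMap.zero_apply]
        exact Ideal.zero_mem _
    · intro c
      rw [add_pow_char_of_commute (p := p) (Commute.all x z), mul_add, map_add]
      exact Ideal.add_mem _ (hx c) (hz c)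

/-- **`p`-POWER FORMS ARE INVISIBLE TO OPERATORS OF ORDER `< p·m` (KERNEL, PROVED)**: if
`f ∈ ⟨h^p : h ∈ P^m⟩ + P^{N+2}` and `N < p·m`, then `D f ∈ P²` for every operator `D` of order `≤ N`.
(Sources: EGAIV4, Prop. 16.8.8; Giraud1975.) -/
theorem apply_mem_sq_of_mem_pPowerSpan {N m : ℕ} {D : A →ₗ[R] A} (hD : IsDiffOpLE R N D) (hN : N < p * m)
    (P : Ideal A) {f : A}
    (hf : f ∈ Ideal.span ((fun h : A => h ^ p) '' ↑(P ^ m)) ⊔ P ^ (N + 2)) : D f ∈ P ^ 2 := by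
  obtain ⟨s, hs, r, hr, rfl⟩ := Submodule.mem_sup.mp hf
  rw [map_add]
  refine Ideal.add_mem _ ?_ ?_
  · suffices h : ∀ c, D (c * s) ∈ P ^ 2 by simpa using h 1
    refine Submodule.span_induction (p := fun s _ => ∀ c, D (c * s) ∈ P ^ 2) ?_ ?_ ?_ ?_ hs
    · rintro _ ⟨h, hh, rfl⟩ c
      exact Ideal.pow_le_pow_right (Fact.out : p.Prime).two_le (apply_mul_pow_mem_pow p P m N D hD hN hh c)
    · intro c; simp
    · intro x z _ _ hx hz c
      rw [mul_add, map_add]; exact Ideal.add_mem _ (hx c) (hz c)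
    · intro a x _ hx c
      rw [smul_eq_mul, ← mul_assoc]; exact hx (c * a)
  · have := hD.apply_mem_pow_sub P (N + 2) hr
    rwa [show N + 2 - N = 2 by omega] at this

/-- **(ideal form)** `J ⊆ ⟨h^p : h ∈ P^m⟩ + P^{N+2}`, `N < p·m` ⇒ `Diff^{≤N}_R(J) ⊆ P²`. (Sources:
EGAIV4, Prop. 16.8.8.) -/
theorem diffIdeal_le_sq_of_le_pPowerSpan {N m : ℕ} (hN : N < p * m) (P : Ideal A) {J : Ideal A}
    (hJ : J ≤ Ideal.span ((fun h : A => h ^ p) '' ↑(P ^ m)) ⊔ P ^ (N + 2)) : diffIdeal R N J ≤ P ^ 2 :=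
  (diffIdeal_le_iff R).mpr fun _ hD _ hf => apply_mem_sq_of_mem_pPowerSpan p hD hN P (hJ hf)

end FrobeniusGain

end Summit.ResolutionOfSingularities.ResolutionOfSingularities.Theorems.HugValuationCut
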